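import Literature.Analysis.FluidPDE.NSMildDuhamel
import Literature.Analysis.UnboundedOperators.HeatKernelBoundedData
import Mathlib.Analysis.SpecificLimits.Basic
import HarnessLib

/-!
# Leray's local existence theorem in `L^∞`: the Picard iteration for the mild Navier–Stokes equations

Analysis/FluidPDE support file, third layer of the physical-space (`L^∞`) theory of mild solutions of
the Navier–Stokes equations with bounded data, towards the discharge of the named fact
`Literature.Analysis.FluidPDE.leray_strong_local_existence` (`NSLerayBlowupRate.lean`). On top of the
Oseen–Duhamel calculus of `NSMildDuhamel.lean` it carries out **Leray's successive approximations**
(Leray 1934, §19, pp. 222–223; Ożański–Pooley 2018, proof of Thm. 6.22, (6.58)–(6.64)) for the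
mild equation

  `u(t) = e^{νtΔ} u₀ - 𝒟_ν[u ⊗ u](t)`,  `𝒟_ν[F](t) = ∫₀ᵗ e^{ν(t-s)Δ} P∇·F(s) ds`,

for a measurable datum `u₀` with `‖u₀‖ ≤ M` pointwise (an `L^∞` datum may always be replaced by such
a representative without changing `e^{νtΔ} u₀`), in dimension three, entirely in the sup norm:

* `heatPart ν u₀ t = e^{νtΔ} u₀` is a bounded (`≤ M`), sup-norm continuous velocity on every `(0, T]`
  (`isBddCtsVelocity_heatExtension`: Lipschitz bound of `e^{aΔ}u₀` from the gradient estimate and the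
  mean value inequality, then the Hölder smoothing estimate of the tree, giving the modulus
  `‖e^{cΔ}u₀ - e^{aΔ}u₀‖_∞ ≤ 21 M ((c-a)/a)^{1/2}`);
* `picardMap`, `picardIter` — `u⁽⁰⁾ = e^{νtΔ} u₀`, `u⁽ⁿ⁺¹⁾ = e^{νtΔ} u₀ - 𝒟_ν[u⁽ⁿ⁾ ⊗ u⁽ⁿ⁾]`; under
  the smallness condition `70632 M ν^{-1/2} T^{1/2} ≤ 1/2` (satisfied by `T ≤ T₀ = ν/(141264 M)²`,
  `picard_smallness` — Leray's `τ = A ν V⁻²(0)`, (3.8)) every iterate is a bounded sup-norm continuous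
  velocity with bound `2M` (`isBddCtsVelocity_picardIter`; Leray: `V⁽ⁿ⁾(t) ≤ (1 + A) V(0)`; OP (6.62))
  with continuous slices;
* `supDist` and the **contraction estimate**
  `‖𝒟_ν[w ⊗ w](t) - 𝒟_ν[v ⊗ v](t)‖ ≤ 17658 ν^{-1/2} (M₁ + M₂) d t^{1/2}`
  (`norm_mildDuhamel_selfTensor_sub_le`; OP (6.63a)), whence the geometric decay
  `sup |u⁽ⁿ⁺¹⁾ - u⁽ⁿ⁾| ≤ M / 2ⁿ` (`supDist_picardIter_succ_le`; Leray: the bound on `v⁽ⁿ⁺¹⁾`);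
* `picardLimit` — the pointwise limit; it is a bounded (`≤ 2M`) sup-norm continuous velocity with
  continuous slices, jointly continuous on `(0, T] × E`, equal to `u₀` at `t ≤ 0`, and **solves the
  mild equation** (`picardLimit_eq_mild`; Leray: "les fonctions `uᵢ⁽ⁿ⁾` convergent uniformément vers
  des limites continues"; OP (6.64)); packaged as `picardLimit_spec` on `(0, T₀]`;
* **uniqueness** on short intervals in the class of bounded sup-norm continuous velocities
  (`eq_of_isBddCtsVelocity_of_mild`: the sup distance satisfies `d ≤ d/2`; Leray 1934, §18;
  OP Lemma 6.21).

The regularity of the solution (Leray §15 / OP Thm. 6.15, Cor. 6.16), its `L²` theory and the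
Leray–Hopf property are the next layers. Everything here is proved; no named facts.

## Mathlib / tree search

Tree: `NSMildDuhamel` (the Oseen–Duhamel integral `mildDuhamel` on the class of bounded, sup-norm
continuous forcings — we build on this theory rather than on the jointly-measurable bounded forcings
of `OseenDuhamelMeasurable.lean`: either would serve the iteration itself, since joint continuity
propagates along the iterates, but the time continuity in `L^∞` carried as data by
`IsBddCtsVelocity` is exactly what the next layers consume — the restart identities and translation
estimates of `NSMildRestart.lean`, and the bridge `IsBddCtsVelocity.continuousInLpOn` to the tree's
`ContinuousInLpOn` used for the Leray–Hopf restarts — so the class is kept from the start),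
`OseenHeatSemigroup`, `HeatKernelBoundedData`
(`norm_fderiv_heatExtension_le_of_bounded`, `norm_heatExtension_sub_self_le_of_holder`,
`norm_heatExtension_le`), `HeatFlowCalculus` (`continuousOn_uncurry_heatExtension_of_memLp`).
`lean search 'picard.*NavierStokes|Picard.*mild|successive approx'`: the tree's Picard iterations are
the Fourier-side `NSFourierPicard` (Schwartz data, weighted sup norms of `û`) and the abstract
`BilinearFixedPoint`; neither gives `L^∞` data with Leray's lifespan. Mathlib:
`cauchySeq_of_le_geometric_two`, `dist_le_of_le_geometric_two_of_tendsto`,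
`TendstoUniformly.continuous`, `Convex.norm_image_sub_le_of_norm_fderiv_le`, `Real.iSup_le`,
`le_ciSup`, `IsOpen.measure_pos`, `tendsto_nhds_unique`.

## References

* J. Leray, *Sur le mouvement d'un liquide visqueux emplissant l'espace*, Acta Math. 63 (1934),
  §18 (comparison of regular solutions), §19 (existence theorem, (3.8), pp. 222–224). [Leray1934]
* W. S. Ożański, B. C. Pooley, *Leray's fundamental work on the Navier–Stokes equations: a modern
  review*, LMS Lecture Note Ser. 452 (CUP 2018), Lemma 6.21, Thm. 6.22 with (6.58)–(6.64).
  [OzanskiPooley2018]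
-/

open MeasureTheory Filter Topology Set InnerProductSpace Metric
open scoped Real ENNReal NNReal Convolution Laplacian RealInnerProductSpace

noncomputable section

namespace Literature.Analysis.FluidPDE

/-! ## The heat part `h(s) = e^{νsΔ} u₀` of the mild equation as a bounded, sup-norm continuous velocity -/

section HeatPart

variable {E : Type*} [NormedAddCommGroup E] [InnerProductSpace ℝ E] [FiniteDimensional ℝ E]
  [MeasurableSpace E] [BorelSpace E]

variable {F' : Type*} [NormedAddCommGroup F'] [NormedSpace ℝ F'] [CompleteSpace F']
variable {u₀ : E → F'} {M ν : ℝ}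

omit [NormedSpace ℝ F'] [CompleteSpace F'] in
/-- A pointwise bounded, a.e. strongly measurable field is in `L^∞`. [folklore] -/
theorem memLp_top_of_forall_norm_le (hm : AEStronglyMeasurable u₀ volume) (hb : ∀ z, ‖u₀ z‖ ≤ M) :
    MemLp u₀ ∞ volume :=
  memLp_top_of_bound hm M (Eventually.of_forall hb)

/-- **Lipschitz bound for the caloric extension of bounded data**:
`‖e^{aΔ}u₀(y) - e^{aΔ}u₀(z)‖ ≤ 2^{n/2} a^{-1/2} M ‖y - z‖` (gradient bound and the mean value
inequality). [folklore] -/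
theorem norm_heatExtension_sub_le_of_bound (hm : AEStronglyMeasurable u₀ volume)
    (hb : ∀ z, ‖u₀ z‖ ≤ M) {a : ℝ} (ha : 0 < a) (y z : E) :
    ‖UnboundedOperators.heatExtension u₀ a y - UnboundedOperators.heatExtension u₀ a z‖ ≤
      (2 : ℝ) ^ ((Module.finrank ℝ E : ℝ) / 2) * a ^ (-(1 / 2 : ℝ)) * M * ‖y - z‖ := by
  have hmem := memLp_top_of_forall_norm_le hm hb
  have hdiff : ∀ x ∈ (univ : Set E), DifferentiableAt ℝ (UnboundedOperators.heatExtension u₀ a) x :=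
    fun x _ => ((UnboundedOperators.contDiff_heatExtension_holds hmem le_top ha).differentiable (by simp)) x
  exact Convex.norm_image_sub_le_of_norm_fderiv_le hdiff
    (fun x _ => UnboundedOperators.norm_fderiv_heatExtension_le_of_bounded hm hb ha x) convex_univ
    (mem_univ z) (mem_univ y)

/-- **Sup-norm modulus of the heat flow of bounded data in time**: for `0 < a ≤ c`,
`‖e^{cΔ}u₀(x) - e^{aΔ}u₀(x)‖ ≤ 21 M ((c - a)/a)^{1/2}` in dimension three
(`e^{cΔ} = e^{(c-a)Δ}e^{aΔ}`, the Lipschitz bound of `e^{aΔ}u₀` and the Hölder smoothing estimate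
`‖e^{tΔ}g - g‖_∞ ≤ (1 + 2·2^{n/2}) [g]_{Lip} t^{1/2}`; `(1 + 2·2^{3/2})·2^{3/2} ≤ 21`). [folklore] -/
theorem norm_heatExtension_sub_heatExtension_le (hE : Module.finrank ℝ E = 3)
    (hm : AEStronglyMeasurable u₀ volume) (hb : ∀ z, ‖u₀ z‖ ≤ M) {a c : ℝ} (ha : 0 < a) (hac : a ≤ c)
    (x : E) :
    ‖UnboundedOperators.heatExtension u₀ c x - UnboundedOperators.heatExtension u₀ a x‖ ≤
      21 * M * ((c - a) / a) ^ (1 / 2 : ℝ) := by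
  have hM0 : 0 ≤ M := (norm_nonneg _).trans (hb x)
  rcases eq_or_lt_of_le hac with h | h
  · subst h
    rw [sub_self, norm_zero, sub_self, zero_div, Real.zero_rpow (by norm_num), mul_zero]
  have hmem := memLp_top_of_forall_norm_le hm hb
  set g := UnboundedOperators.heatExtension u₀ a with hg
  -- `e^{cΔ}u₀ = e^{(c-a)Δ} g`
  have hsemi : UnboundedOperators.heatExtension u₀ c = UnboundedOperators.heatExtension g (c - a) := by
    rw [hg, UnboundedOperators.heatExtension_add_holds hmem le_top ha (sub_pos.2 h), add_sub_cancel]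
  rw [hsemi]
  have hgc : Continuous g := (UnboundedOperators.contDiff_heatExtension_holds hmem le_top ha).continuous
  have hgb : ∀ z, ‖g z‖ ≤ M := fun z => UnboundedOperators.norm_heatExtension_le hb ha z
  set L : ℝ := (2 : ℝ) ^ ((Module.finrank ℝ E : ℝ) / 2) * a ^ (-(1 / 2 : ℝ)) * M with hL
  have hL0 : 0 ≤ L := by rw [hL]; positivity
  have hLip : ∀ y z, ‖g y - g z‖ ≤ L * ‖y - z‖ ^ (1 : ℝ) := fun y z => by
    rw [Real.rpow_one]; exact norm_heatExtension_sub_le_of_bound hm hb ha y z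
  have h1 := UnboundedOperators.norm_heatExtension_sub_self_le_of_holder hgc hgb hL0 zero_le_one le_rfl hLip
    (sub_pos.2 h) x
  refine h1.trans ?_
  -- constants: `(1 + 2·2^{3/2}) · 2^{3/2} ≤ 21`, and `a^{-1/2} (c-a)^{1/2} = ((c-a)/a)^{1/2}`
  have h2 : (2 : ℝ) ^ ((Module.finrank ℝ E : ℝ) / 2) ≤ 3 := by
    rw [hE, show ((3 : ℕ) : ℝ) / 2 = (3 / 2 : ℝ) by norm_num]; exact two_rpow_three_halves_le_three
  have hca : 0 < c - a := sub_pos.2 h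
  have hr : a ^ (-(1 / 2 : ℝ)) * (c - a) ^ ((1 : ℝ) / 2) = ((c - a) / a) ^ (1 / 2 : ℝ) := by
    rw [Real.div_rpow hca.le ha.le, Real.rpow_neg ha.le, show ((1 : ℝ) / 2) = (1 / 2 : ℝ) by norm_num]
    ring
  have hq : 0 ≤ ((c - a) / a) ^ (1 / 2 : ℝ) := Real.rpow_nonneg (div_nonneg hca.le ha.le) _
  calc (1 + 2 * (2 : ℝ) ^ ((Module.finrank ℝ E : ℝ) / 2)) * L * (c - a) ^ ((1 : ℝ) / 2)
      = (1 + 2 * (2 : ℝ) ^ ((Module.finrank ℝ E : ℝ) / 2)) * (2 : ℝ) ^ ((Module.finrank ℝ E : ℝ) / 2) * M *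
          (a ^ (-(1 / 2 : ℝ)) * (c - a) ^ ((1 : ℝ) / 2)) := by rw [hL]; ring
    _ = (1 + 2 * (2 : ℝ) ^ ((Module.finrank ℝ E : ℝ) / 2)) * (2 : ℝ) ^ ((Module.finrank ℝ E : ℝ) / 2) * M *
          ((c - a) / a) ^ (1 / 2 : ℝ) := by rw [hr]
    _ ≤ (1 + 2 * 3) * 3 * M * ((c - a) / a) ^ (1 / 2 : ℝ) := by gcongr
    _ = 21 * M * ((c - a) / a) ^ (1 / 2 : ℝ) := by ring

/-- **Sup-norm continuity of the heat part in time** within `(0, T]`. [folklore] -/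
theorem tendsto_eLpNorm_heatPart_sub (hE : Module.finrank ℝ E = 3) (hm : AEStronglyMeasurable u₀ volume)
    (hb : ∀ z, ‖u₀ z‖ ≤ M) (hν : 0 < ν) {T s : ℝ} (hs : s ∈ Ioc 0 T) :
    Tendsto (fun s' => eLpNorm (fun y => UnboundedOperators.heatExtension u₀ (ν * s') y -
      UnboundedOperators.heatExtension u₀ (ν * s) y) ∞ volume) (𝓝[Ioc 0 T] s) (𝓝 0) := by
    have hM0 : 0 ≤ M := (norm_nonneg _).trans (hb 0)
    -- the majorant `21 M (|s' - s| / min s s')^{1/2}`, for `s'` near `s` with `s' > s/2`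
    have hmaj : ∀ s' ∈ Ioc 0 T, s / 2 < s' → ∀ x,
        ‖UnboundedOperators.heatExtension u₀ (ν * s') x - UnboundedOperators.heatExtension u₀ (ν * s) x‖ ≤
          21 * M * (|s' - s| / (s / 2)) ^ (1 / 2 : ℝ) := by
      intro s' hs' hs2 x
      have hs0 : 0 < s := hs.1
      have hs'0 : 0 < s' := hs'.1
      rcases le_total s s' with h | h
      · have h1 := norm_heatExtension_sub_heatExtension_le hE hm hb (mul_pos hν hs0)
          (mul_le_mul_of_nonneg_left h hν.le) x
        refine h1.trans (mul_le_mul_of_nonneg_left (Real.rpow_le_rpow ?_ ?_ (by norm_num)) (by positivity))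
        · exact div_nonneg (sub_nonneg.2 (mul_le_mul_of_nonneg_left h hν.le)) (mul_pos hν hs0).le
        · rw [abs_of_nonneg (sub_nonneg.2 h), show ν * s' - ν * s = ν * (s' - s) by ring,
            mul_div_mul_left _ _ hν.ne']
          exact div_le_div_of_nonneg_left (sub_nonneg.2 h) (half_pos hs0) (by linarith)
      · rw [norm_sub_rev]
        have h1 := norm_heatExtension_sub_heatExtension_le hE hm hb (mul_pos hν hs'0)
          (mul_le_mul_of_nonneg_left h hν.le) x
        refine h1.trans (mul_le_mul_of_nonneg_left (Real.rpow_le_rpow ?_ ?_ (by norm_num)) (by positivity))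
        · exact div_nonneg (sub_nonneg.2 (mul_le_mul_of_nonneg_left h hν.le)) (mul_pos hν hs'0).le
        · rw [abs_of_nonpos (sub_nonpos.2 h), neg_sub, show ν * s - ν * s' = ν * (s - s') by ring,
            mul_div_mul_left _ _ hν.ne']
          exact div_le_div_of_nonneg_left (sub_nonneg.2 h) (half_pos hs0) hs2.le
    -- the majorant tends to zero
    have hlim : Tendsto (fun s' => ENNReal.ofReal (21 * M * (|s' - s| / (s / 2)) ^ (1 / 2 : ℝ))) (𝓝[Ioc 0 T] s)
        (𝓝 0) := by
      have h1 : Tendsto (fun s' : ℝ => |s' - s| / (s / 2)) (𝓝 s) (𝓝 0) := by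
        have hc : Continuous fun s' : ℝ => |s' - s| / (s / 2) := ((continuous_id.sub continuous_const).abs).div_const _
        have := hc.tendsto s
        simpa using this
      have h2 : Tendsto (fun s' : ℝ => 21 * M * (|s' - s| / (s / 2)) ^ (1 / 2 : ℝ)) (𝓝 s) (𝓝 0) := by
        have := (h1.rpow_const (p := (1 / 2 : ℝ)) (Or.inr (by norm_num))).const_mul (21 * M)
        rwa [Real.zero_rpow (by norm_num), mul_zero] at this
      have h3 := ENNReal.tendsto_ofReal (h2.mono_left (nhdsWithin_le_nhds (s := Ioc 0 T)))
      rwa [ENNReal.ofReal_zero] at h3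
    refine tendsto_of_tendsto_of_tendsto_of_le_of_le' tendsto_const_nhds hlim
      (Eventually.of_forall fun _ => bot_le) ?_
    have hnear : ∀ᶠ s' in 𝓝[Ioc 0 T] s, s / 2 < s' :=
      mem_nhdsWithin_of_mem_nhds (Ioi_mem_nhds (half_lt_self hs.1))
    filter_upwards [eventually_mem_nhdsWithin, hnear] with s' hs' hs2
    rw [eLpNorm_exponent_top]
    exact eLpNormEssSup_le_of_ae_bound (Eventually.of_forall fun x => hmaj s' hs' hs2 x)

variable {u₀ : E → E}

/-- **The heat part `s ↦ e^{νsΔ} u₀` of the mild equation is a bounded, sup-norm continuous velocity**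
on every `(0, T]` (bound `M = sup ‖u₀‖`; sup-norm continuity from the modulus above). [folklore] -/
theorem isBddCtsVelocity_heatExtension (hE : Module.finrank ℝ E = 3) (hm : AEStronglyMeasurable u₀ volume)
    (hb : ∀ z, ‖u₀ z‖ ≤ M) (hν : 0 < ν) (T : ℝ) :
    IsBddCtsVelocity T M (fun s => UnboundedOperators.heatExtension u₀ (ν * s)) := by
  refine ⟨fun s hs => ?_, fun s hs y => ?_, (norm_nonneg _).trans (hb 0), fun s hs => ?_⟩
  · exact (UnboundedOperators.contDiff_heatExtension_holds (memLp_top_of_forall_norm_le hm hb) le_top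
      (mul_pos hν hs.1)).continuous.aestronglyMeasurable
  · exact UnboundedOperators.norm_heatExtension_le hb (mul_pos hν hs.1) y
  · exact tendsto_eLpNorm_heatPart_sub hE hm hb hν hs

/-- **Joint continuity of the heat part** `(s, x) ↦ e^{νsΔ} u₀ (x)` on `(0, ∞) × E`. [folklore] -/
theorem continuousOn_uncurry_heatPart (hm : AEStronglyMeasurable u₀ volume) (hb : ∀ z, ‖u₀ z‖ ≤ M)
    (hν : 0 < ν) :
    ContinuousOn (fun q : ℝ × E => UnboundedOperators.heatExtension u₀ (ν * q.1) q.2) (Ioi 0 ×ˢ univ) := by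
  have h : ContinuousOn (fun q : ℝ × E => UnboundedOperators.heatExtension u₀ q.1 q.2) (Ioi 0 ×ˢ univ) :=
    UnboundedOperators.continuousOn_uncurry_heatExtension_of_memLp (memLp_top_of_forall_norm_le hm hb) le_top
  have hg : Continuous fun q : ℝ × E => ((ν * q.1, q.2) : ℝ × E) :=
    (continuous_const.mul continuous_fst).prodMk continuous_snd
  have hmaps : MapsTo (fun q : ℝ × E => ((ν * q.1, q.2) : ℝ × E)) (Ioi 0 ×ˢ univ) (Ioi 0 ×ˢ univ) := by
    rintro ⟨s, x⟩ ⟨hs, -⟩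
    exact ⟨mul_pos hν hs, mem_univ _⟩
  have h2 := ContinuousOn.comp h hg.continuousOn hmaps
  refine h2.congr fun q _ => ?_
  rfl

end HeatPart

/-! ## The Picard iteration for the mild Navier–Stokes equations with bounded data -/

section Picard

variable {E : Type*} [NormedAddCommGroup E] [InnerProductSpace ℝ E] [FiniteDimensional ℝ E]
  [MeasurableSpace E] [BorelSpace E]

/-- The **heat part** `e^{νtΔ} u₀` of the mild equation. [folklore] -/
def heatPart (ν : ℝ) (u₀ : E → E) (t : ℝ) (x : E) : E :=
  UnboundedOperators.heatExtension u₀ (ν * t) x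

/-- The **tensor forcing** `s ↦ v(s) ⊗ v(s)` of a velocity field. [folklore] -/
def selfTensor (v : ℝ → E → E) (s : ℝ) : Fin (Module.finrank ℝ E) → Fin (Module.finrank ℝ E) → E → ℝ :=
  frameTensor (v s) (v s)

/-- **The Picard map** `Φ(v)(t) = e^{νtΔ} u₀ - 𝒟_ν[v ⊗ v](t)` of the mild Navier–Stokes equations
(Leray 1934, §19, the successive approximations; Ożański–Pooley 2018, proof of Thm. 6.22), for
`t > 0`; for `t ≤ 0` it is the datum `u₀`. [folklore] -/
def picardMap (ν : ℝ) (u₀ : E → E) (v : ℝ → E → E) (t : ℝ) (x : E) : E :=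
  if 0 < t then heatPart ν u₀ t x - mildDuhamel ν (selfTensor v) t x else u₀ x

/-- **The Picard iterates** `u⁽⁰⁾(t) = e^{νtΔ} u₀`, `u⁽ⁿ⁺¹⁾ = Φ(u⁽ⁿ⁾)` (Leray 1934, §19, p. 222;
Ożański–Pooley 2018, proof of Thm. 6.22). [folklore] -/
def picardIter (ν : ℝ) (u₀ : E → E) : ℕ → ℝ → E → E
  | 0 => fun t x => if 0 < t then heatPart ν u₀ t x else u₀ x
  | n + 1 => picardMap ν u₀ (picardIter ν u₀ n)

variable {ν M T : ℝ} {u₀ : E → E}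

/-- At positive times the Picard map is `e^{νtΔ} u₀ - 𝒟_ν[v ⊗ v](t)`. [folklore] -/
theorem picardMap_of_pos (v : ℝ → E → E) {t : ℝ} (ht : 0 < t) :
    picardMap ν u₀ v t = fun x => heatPart ν u₀ t x - mildDuhamel ν (selfTensor v) t x := by
  funext x; simp [picardMap, ht]

/-- At nonpositive times every Picard iterate is the datum. [folklore] -/
theorem picardIter_of_nonpos (n : ℕ) {t : ℝ} (ht : t ≤ 0) (x : E) : picardIter ν u₀ n t x = u₀ x := by
  cases n with
  | zero => simp [picardIter, not_lt.2 ht]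
  | succ n => simp [picardIter, picardMap, not_lt.2 ht]

/-- At positive times the zeroth iterate is the heat part. [folklore] -/
theorem picardIter_zero_of_pos {t : ℝ} (ht : 0 < t) :
    picardIter ν u₀ 0 t = fun x => heatPart ν u₀ t x := by
  funext x; simp [picardIter, ht]

/-- At positive times the successor iterate is the Picard map of its predecessor. [folklore] -/
theorem picardIter_succ_of_pos (n : ℕ) {t : ℝ} (ht : 0 < t) :
    picardIter ν u₀ (n + 1) t = fun x => heatPart ν u₀ t x - mildDuhamel ν (selfTensor (picardIter ν u₀ n)) t x := by
  show picardMap ν u₀ (picardIter ν u₀ n) t = _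
  exact picardMap_of_pos _ ht

/-- Transport of the velocity class along equality of the slices on `(0, T]`. [folklore] -/
theorem IsBddCtsVelocity.congr {v w : ℝ → E → E} (hv : IsBddCtsVelocity T M v)
    (h : ∀ s ∈ Ioc 0 T, v s = w s) : IsBddCtsVelocity T M w where
  meas s hs := by rw [← h s hs]; exact hv.meas s hs
  bound s hs y := by rw [← h s hs]; exact hv.bound s hs y
  nonneg := hv.nonneg
  cont s hs := by
    refine (hv.cont s hs).congr' ?_
    filter_upwards [eventually_mem_nhdsWithin] with s' hs'
    rw [h s hs, h s' hs']

/-- **The difference of the heat part and the Oseen–Duhamel integral of a bounded continuous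
forcing is a bounded, sup-norm continuous velocity** — the form of every Picard iterate — provided the
Duhamel integral is bounded by `M'` on `(0, T]`. [folklore] -/
theorem isBddCtsVelocity_heatPart_sub_mildDuhamel (hE : Module.finrank ℝ E = 3)
    (hm : AEStronglyMeasurable u₀ volume) (hb : ∀ z, ‖u₀ z‖ ≤ M) (hν : 0 < ν) {B : ℝ}
    {F : ℝ → Fin (Module.finrank ℝ E) → Fin (Module.finrank ℝ E) → E → ℝ} (hF : IsBddCtsForcing T B F)
    {M' : ℝ} (hM'0 : 0 ≤ M') (hM' : ∀ t ∈ Ioc 0 T, ∀ x, ‖mildDuhamel ν F t x‖ ≤ M') {w : ℝ → E → E}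
    (hw : ∀ t ∈ Ioc 0 T, w t = fun x => heatPart ν u₀ t x - mildDuhamel ν F t x) :
    IsBddCtsVelocity T (M + M') w := by
  have hh := isBddCtsVelocity_heatExtension hE hm hb hν T
  refine IsBddCtsVelocity.congr (v := fun t x => heatPart ν u₀ t x - mildDuhamel ν F t x) ?_
    (fun s hs => (hw s hs).symm)
  refine ⟨fun s hs => ?_, fun s hs y => ?_, add_nonneg hh.nonneg hM'0, fun s hs => ?_⟩
  · exact ((hh.meas s hs).sub (continuous_mildDuhamel_space hE hF hν hs).aestronglyMeasurable)
  · exact (norm_sub_le _ _).trans (add_le_add (hh.bound s hs y) (hM' s hs y))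
  · have h1 := hh.cont s hs
    have h2 := (tendsto_eLpNorm_mildDuhamel_sub hE hF hν ⟨hs.1.le, hs.2⟩).mono_left
      (nhdsWithin_mono _ Ioc_subset_Icc_self)
    have h12 := h1.add h2
    rw [add_zero] at h12
    refine tendsto_of_tendsto_of_tendsto_of_le_of_le' tendsto_const_nhds h12
      (Eventually.of_forall fun _ => bot_le) ?_
    filter_upwards [eventually_mem_nhdsWithin] with s' hs'
    have heq : (fun y => (heatPart ν u₀ s' y - mildDuhamel ν F s' y) - (heatPart ν u₀ s y - mildDuhamel ν F s y)) =
        (fun y => heatPart ν u₀ s' y - heatPart ν u₀ s y) - fun y => mildDuhamel ν F s' y - mildDuhamel ν F s y := by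
      funext y; simp only [Pi.sub_apply]; abel
    rw [heq]
    exact eLpNorm_sub_le ((hh.meas s' hs').sub (hh.meas s hs))
      ((continuous_mildDuhamel_space hE hF hν hs').aestronglyMeasurable.sub
        (continuous_mildDuhamel_space hE hF hν hs).aestronglyMeasurable) le_top

/-- **Every Picard iterate is a bounded, sup-norm continuous velocity with bound `2M`** on `(0, T]`,
provided `T` is small: `70632 M ν^{-1/2} T^{1/2} ≤ 1/2` (then `‖𝒟_ν[u⁽ⁿ⁾ ⊗ u⁽ⁿ⁾](t)‖ ≤ M/2`).
Leray 1934, §19: `V⁽ⁿ⁾(t) ≤ (1 + A) V(0)` for `t ≤ τ = A ν V⁻²(0)`; Ożański–Pooley 2018, (6.62).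
[folklore] -/
theorem isBddCtsVelocity_picardIter (hE : Module.finrank ℝ E = 3) (hm : AEStronglyMeasurable u₀ volume)
    (hb : ∀ z, ‖u₀ z‖ ≤ M) (hν : 0 < ν) (hT : 70632 * M * ν ^ (-(1 / 2 : ℝ)) * T ^ (1 / 2 : ℝ) ≤ 1 / 2) :
    ∀ n, IsBddCtsVelocity T (2 * M) (picardIter ν u₀ n) := by
  have hM0 : 0 ≤ M := (norm_nonneg _).trans (hb 0)
  have hh := isBddCtsVelocity_heatExtension hE hm hb hν T
  intro n
  induction n with
  | zero =>
    have h2 : IsBddCtsVelocity T (2 * M) (fun t x => heatPart ν u₀ t x) :=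
      ⟨hh.meas, fun s hs y => (hh.bound s hs y).trans (by linarith), by linarith [hh.nonneg], hh.cont⟩
    exact h2.congr fun s hs => (picardIter_zero_of_pos hs.1).symm
  | succ n ih =>
    have hF : IsBddCtsForcing T (2 * M * (2 * M)) (selfTensor (picardIter ν u₀ n)) :=
      ih.isBddCtsForcing_frameTensor ih
    have hD : ∀ t ∈ Ioc 0 T, ∀ x, ‖mildDuhamel ν (selfTensor (picardIter ν u₀ n)) t x‖ ≤ M := by
      intro t ht x
      refine (norm_mildDuhamel_le hE hF hν ht x).trans ?_
      have ht2 : t ^ (1 / 2 : ℝ) ≤ T ^ (1 / 2 : ℝ) := Real.rpow_le_rpow ht.1.le ht.2 (by norm_num)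
      have hν0 : 0 ≤ ν ^ (-(1 / 2 : ℝ)) := Real.rpow_nonneg hν.le _
      calc 17658 * ν ^ (-(1 / 2 : ℝ)) * (2 * M * (2 * M)) * t ^ (1 / 2 : ℝ)
          ≤ 17658 * ν ^ (-(1 / 2 : ℝ)) * (2 * M * (2 * M)) * T ^ (1 / 2 : ℝ) := by gcongr
        _ = M * (70632 * M * ν ^ (-(1 / 2 : ℝ)) * T ^ (1 / 2 : ℝ)) := by ring
        _ ≤ M * (1 / 2) := mul_le_mul_of_nonneg_left hT hM0
        _ ≤ M := by linarith
    have := isBddCtsVelocity_heatPart_sub_mildDuhamel hE hm hb hν hF hM0 hD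
      (w := picardIter ν u₀ (n + 1)) (fun t ht => picardIter_succ_of_pos n ht.1)
    rwa [show M + M = 2 * M by ring] at this

/-- **Continuity of the slices of the Picard iterates** at positive times. [folklore] -/
theorem continuous_picardIter (hE : Module.finrank ℝ E = 3) (hm : AEStronglyMeasurable u₀ volume)
    (hb : ∀ z, ‖u₀ z‖ ≤ M) (hν : 0 < ν) (hT : 70632 * M * ν ^ (-(1 / 2 : ℝ)) * T ^ (1 / 2 : ℝ) ≤ 1 / 2)
    (n : ℕ) {t : ℝ} (ht : t ∈ Ioc 0 T) : Continuous (picardIter ν u₀ n t) := by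
  have hmem := memLp_top_of_forall_norm_le hm hb
  have hhc : Continuous (heatPart ν u₀ t) :=
    (UnboundedOperators.contDiff_heatExtension_holds hmem le_top (mul_pos hν ht.1)).continuous
  cases n with
  | zero => rw [picardIter_zero_of_pos ht.1]; exact hhc
  | succ n =>
    rw [picardIter_succ_of_pos n ht.1]
    have ih := isBddCtsVelocity_picardIter hE hm hb hν hT n
    exact hhc.sub (continuous_mildDuhamel_space hE (ih.isBddCtsForcing_frameTensor ih) hν ht)

end Picard

/-! ## Sup distances, the contraction estimate, and the limit of the Picard iteration -/

section PicardLimit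

variable {E : Type*} [NormedAddCommGroup E] [InnerProductSpace ℝ E] [FiniteDimensional ℝ E]
  [MeasurableSpace E] [BorelSpace E]

/-- The **sup distance** of two velocity fields over `(0, T] × E` (a real supremum; `0` if `T ≤ 0`).
[folklore] -/
def supDist (T : ℝ) (v w : ℝ → E → E) : ℝ :=
  ⨆ q : {q : ℝ × E // q.1 ∈ Ioc 0 T}, ‖v q.1.1 q.1.2 - w q.1.1 q.1.2‖

variable {T : ℝ} {v w : ℝ → E → E}

omit [InnerProductSpace ℝ E] [FiniteDimensional ℝ E] [MeasurableSpace E] [BorelSpace E] in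
/-- The sup distance is nonnegative. [folklore] -/
theorem supDist_nonneg : 0 ≤ supDist T v w :=
  Real.iSup_nonneg fun _ => norm_nonneg _

omit [InnerProductSpace ℝ E] [FiniteDimensional ℝ E] [MeasurableSpace E] [BorelSpace E] in
/-- A uniform bound of the pointwise distances bounds the sup distance. [folklore] -/
theorem supDist_le {a : ℝ} (ha : 0 ≤ a) (h : ∀ t ∈ Ioc 0 T, ∀ x, ‖v t x - w t x‖ ≤ a) :
    supDist T v w ≤ a :=
  Real.iSup_le (fun q => h q.1.1 q.2 q.1.2) ha

omit [InnerProductSpace ℝ E] [FiniteDimensional ℝ E] [MeasurableSpace E] [BorelSpace E] in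
/-- Pointwise distances are bounded by the sup distance, given any uniform bound (for `BddAbove`).
[folklore] -/
theorem norm_sub_le_supDist {a : ℝ} (h : ∀ t ∈ Ioc 0 T, ∀ x, ‖v t x - w t x‖ ≤ a) {t : ℝ}
    (ht : t ∈ Ioc 0 T) (x : E) : ‖v t x - w t x‖ ≤ supDist T v w := by
  have hbdd : BddAbove (range fun q : {q : ℝ × E // q.1 ∈ Ioc 0 T} => ‖v q.1.1 q.1.2 - w q.1.1 q.1.2‖) :=
    ⟨a, by rintro _ ⟨q, rfl⟩; exact h q.1.1 q.2 q.1.2⟩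
  exact le_ciSup hbdd ⟨(t, x), ht⟩

omit [InnerProductSpace ℝ E] [FiniteDimensional ℝ E] [MeasurableSpace E] [BorelSpace E] in
/-- Bounded fields have pointwise distances at most `M₁ + M₂`. [folklore] -/
theorem norm_sub_le_add_of_bounds {M₁ M₂ : ℝ} (hv : ∀ t ∈ Ioc 0 T, ∀ x, ‖v t x‖ ≤ M₁)
    (hw : ∀ t ∈ Ioc 0 T, ∀ x, ‖w t x‖ ≤ M₂) : ∀ t ∈ Ioc 0 T, ∀ x, ‖v t x - w t x‖ ≤ M₁ + M₂ :=
  fun t ht x => (norm_sub_le _ _).trans (add_le_add (hv t ht x) (hw t ht x))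

/-- A pointwise bound on `(0, T]` gives an `L^∞` bound of the slice differences. [folklore] -/
theorem eLpNorm_sub_le_of_supDist {a : ℝ} (h : ∀ t ∈ Ioc 0 T, ∀ x, ‖v t x - w t x‖ ≤ a) {t : ℝ}
    (ht : t ∈ Ioc 0 T) : eLpNorm (fun y => v t y - w t y) ∞ volume ≤ ENNReal.ofReal (supDist T v w) := by
  rw [eLpNorm_exponent_top]
  exact eLpNormEssSup_le_of_ae_bound (Eventually.of_forall fun y => norm_sub_le_supDist h ht y)

variable (hE : Module.finrank ℝ E = 3)
include hE

variable {ν M M₁ M₂ : ℝ} {u₀ : E → E}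

/-- **The contraction estimate for the Picard map** (Leray 1934, §19, the bound on `v⁽ⁿ⁺¹⁾`;
Ożański–Pooley 2018, (6.63a)): for bounded, sup-norm continuous `v`, `w` with bounds `M₁`, `M₂` on
`(0, T]`, `‖𝒟_ν[w ⊗ w](t)(x) - 𝒟_ν[v ⊗ v](t)(x)‖ ≤ 17658 ν^{-1/2} (M₁ + M₂) d t^{1/2}` with `d` the sup
distance of `v` and `w` (`w ⊗ w - v ⊗ v = (w - v) ⊗ w + v ⊗ (w - v)`). [folklore] -/
theorem norm_mildDuhamel_selfTensor_sub_le (hv : IsBddCtsVelocity T M₁ v) (hw : IsBddCtsVelocity T M₂ w)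
    (hν : 0 < ν) {t : ℝ} (ht : t ∈ Ioc 0 T) (x : E) :
    ‖mildDuhamel ν (selfTensor w) t x - mildDuhamel ν (selfTensor v) t x‖ ≤
      17658 * ν ^ (-(1 / 2 : ℝ)) * ((M₁ + M₂) * supDist T v w) * t ^ (1 / 2 : ℝ) := by
  have hd0 : 0 ≤ supDist T v w := supDist_nonneg
  have hpt := norm_sub_le_add_of_bounds hv.bound hw.bound
  -- the difference forcing and its componentwise bound `(M₁ + M₂) d`
  have hBd : ∀ s ∈ Ioc 0 T, ∀ j k, eLpNorm (fun y => selfTensor w s j k y - selfTensor v s j k y) ∞ volume ≤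
      ENNReal.ofReal ((M₁ + M₂) * supDist T v w) := by
    intro s hs j k
    have hvm := memLp_top_of_bound (hv.meas s hs) M₁ (Eventually.of_forall (hv.bound s hs))
    have hwm := memLp_top_of_bound (hw.meas s hs) M₂ (Eventually.of_forall (hw.bound s hs))
    have hdm : MemLp (fun y => w s y - v s y) ∞ volume := hwm.sub hvm
    have hde : eLpNorm (fun y => w s y - v s y) ∞ volume ≤ ENNReal.ofReal (supDist T v w) := by
      have := eLpNorm_sub_le_of_supDist (fun t ht x => by rw [norm_sub_rev]; exact hpt t ht x) hs (v := w) (w := v)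
      -- `supDist` is symmetric in the fields up to the norm of the difference
      have hsym : supDist T w v = supDist T v w := by
        unfold supDist; congr 1; funext q; rw [norm_sub_rev]
      rwa [hsym] at this
    have heq : (fun y => selfTensor w s j k y - selfTensor v s j k y) =
        frameTensor (fun y => w s y - v s y) (w s) j k + frameTensor (v s) (fun y => w s y - v s y) j k := by
      funext y
      show frameTensor (w s) (w s) j k y - frameTensor (v s) (v s) j k y = _
      rw [frameTensor_sub_frameTensor]
      rfl
    rw [heq]
    refine (eLpNorm_add_le (aestronglyMeasurable_frameTensor hdm.1 (hw.meas s hs) j k)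
      (aestronglyMeasurable_frameTensor (hv.meas s hs) hdm.1 j k) le_top).trans ?_
    have h1 := eLpNorm_frameTensor_le_left hdm (hw.meas s hs) (hw.bound s hs) j k
    have h2 := eLpNorm_frameTensor_le_right (hv.meas s hs) (hv.bound s hs) hv.nonneg hdm j k
    calc _ ≤ eLpNorm (fun y => w s y - v s y) ∞ volume * ENNReal.ofReal M₂ +
          ENNReal.ofReal M₁ * eLpNorm (fun y => w s y - v s y) ∞ volume := add_le_add h1 h2
      _ ≤ ENNReal.ofReal (supDist T v w) * ENNReal.ofReal M₂ + ENNReal.ofReal M₁ * ENNReal.ofReal (supDist T v w) := by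
          gcongr
      _ = ENNReal.ofReal ((M₁ + M₂) * supDist T v w) := by
          rw [← ENNReal.ofReal_mul hd0, ← ENNReal.ofReal_mul hv.nonneg, ← ENNReal.ofReal_add (by positivity [hw.nonneg])
            (mul_nonneg hv.nonneg hd0)]
          congr 1; ring
  have hFw := hw.isBddCtsForcing_frameTensor hw
  have hFv := hv.isBddCtsForcing_frameTensor hv
  have hdiff : IsBddCtsForcing T ((M₁ + M₂) * supDist T v w) (fun s j k y => selfTensor w s j k y - selfTensor v s j k y) :=
    hFw.sub hFv (mul_nonneg (add_nonneg hv.nonneg hw.nonneg) hd0) hBd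
  change ‖mildDuhamel ν (fun s => frameTensor (w s) (w s)) t x -
    mildDuhamel ν (fun s => frameTensor (v s) (v s)) t x‖ ≤ _
  rw [mildDuhamel_sub hE hFw hFv hν ht x]
  exact norm_mildDuhamel_le hE hdiff hν ht x

/-- **Uniqueness of bounded, sup-norm continuous solutions of the mild equation on a short interval**
(Leray 1934, §18 in the integral form; Ożański–Pooley 2018, Lemma 6.21): if `v` and `w` solve
`u(t) = g(t) - 𝒟_ν[u ⊗ u](t)` on `(0, T]` with the same free part `g`, with bounds `M₁`, `M₂`, and
`17658 ν^{-1/2} (M₁ + M₂) T^{1/2} ≤ 1/2`, then `v = w` on `(0, T]`: the sup distance `d` satisfies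
`d ≤ d/2`. [folklore] -/
theorem eq_of_isBddCtsVelocity_of_mild (hv : IsBddCtsVelocity T M₁ v) (hw : IsBddCtsVelocity T M₂ w)
    (hν : 0 < ν) {g : ℝ → E → E}
    (hvg : ∀ t ∈ Ioc 0 T, ∀ x, v t x = g t x - mildDuhamel ν (selfTensor v) t x)
    (hwg : ∀ t ∈ Ioc 0 T, ∀ x, w t x = g t x - mildDuhamel ν (selfTensor w) t x)
    (hT : 17658 * ν ^ (-(1 / 2 : ℝ)) * (M₁ + M₂) * T ^ (1 / 2 : ℝ) ≤ 1 / 2) :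
    ∀ t ∈ Ioc 0 T, v t = w t := by
  have hd0 : 0 ≤ supDist T v w := supDist_nonneg
  have hpt := norm_sub_le_add_of_bounds hv.bound hw.bound
  have hhalf : supDist T v w ≤ supDist T v w / 2 := by
    refine supDist_le (by linarith) fun t ht x => ?_
    have ht2 : t ^ (1 / 2 : ℝ) ≤ T ^ (1 / 2 : ℝ) := Real.rpow_le_rpow ht.1.le ht.2 (by norm_num)
    rw [hvg t ht x, hwg t ht x, sub_sub_sub_cancel_left]
    refine (norm_mildDuhamel_selfTensor_sub_le hE hv hw hν ht x).trans ?_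
    have hK0 : 0 ≤ 17658 * ν ^ (-(1 / 2 : ℝ)) * (M₁ + M₂) :=
      mul_nonneg (by positivity) (add_nonneg hv.nonneg hw.nonneg)
    calc 17658 * ν ^ (-(1 / 2 : ℝ)) * ((M₁ + M₂) * supDist T v w) * t ^ (1 / 2 : ℝ)
        = (17658 * ν ^ (-(1 / 2 : ℝ)) * (M₁ + M₂) * t ^ (1 / 2 : ℝ)) * supDist T v w := by ring
      _ ≤ (17658 * ν ^ (-(1 / 2 : ℝ)) * (M₁ + M₂) * T ^ (1 / 2 : ℝ)) * supDist T v w := by gcongr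
      _ ≤ (1 / 2) * supDist T v w := mul_le_mul_of_nonneg_right hT hd0
      _ = supDist T v w / 2 := by ring
  have hd : supDist T v w = 0 := le_antisymm (by linarith) hd0
  intro t ht
  funext x
  have := norm_sub_le_supDist hpt ht x
  rw [hd] at this
  exact sub_eq_zero.1 (norm_le_zero_iff.1 this)

/-! ### The Picard iterates converge -/

variable (hm : AEStronglyMeasurable u₀ volume) (hb : ∀ z, ‖u₀ z‖ ≤ M) (hν : 0 < ν)
  (hT : 70632 * M * ν ^ (-(1 / 2 : ℝ)) * T ^ (1 / 2 : ℝ) ≤ 1 / 2)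
include hm hb hν hT

/-- `‖𝒟_ν[u⁽ⁿ⁾ ⊗ u⁽ⁿ⁾](t)(x)‖ ≤ M/2` on `(0, T]` under the smallness of `T`. [folklore] -/
theorem norm_mildDuhamel_picardIter_le (n : ℕ) {t : ℝ} (ht : t ∈ Ioc 0 T) (x : E) :
    ‖mildDuhamel ν (selfTensor (picardIter ν u₀ n)) t x‖ ≤ M / 2 := by
  have hM0 : 0 ≤ M := (norm_nonneg _).trans (hb 0)
  have ih := isBddCtsVelocity_picardIter hE hm hb hν hT n
  have hF := ih.isBddCtsForcing_frameTensor ih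
  refine (norm_mildDuhamel_le hE hF hν ht x).trans ?_
  have ht2 : t ^ (1 / 2 : ℝ) ≤ T ^ (1 / 2 : ℝ) := Real.rpow_le_rpow ht.1.le ht.2 (by norm_num)
  have hν0 : 0 ≤ ν ^ (-(1 / 2 : ℝ)) := Real.rpow_nonneg hν.le _
  calc 17658 * ν ^ (-(1 / 2 : ℝ)) * (2 * M * (2 * M)) * t ^ (1 / 2 : ℝ)
      ≤ 17658 * ν ^ (-(1 / 2 : ℝ)) * (2 * M * (2 * M)) * T ^ (1 / 2 : ℝ) := by gcongr
    _ = M * (70632 * M * ν ^ (-(1 / 2 : ℝ)) * T ^ (1 / 2 : ℝ)) := by ring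
    _ ≤ M * (1 / 2) := mul_le_mul_of_nonneg_left hT hM0
    _ = M / 2 := by ring

/-- **Geometric decay of consecutive Picard iterates**: the sup distance of `u⁽ⁿ⁺¹⁾` and `u⁽ⁿ⁾` on
`(0, T]` is at most `M / 2ⁿ` (Leray 1934, §19: `v⁽ⁿ⁺¹⁾ ≤ A V(0) ∫ v⁽ⁿ⁾`; Ożański–Pooley 2018, (6.64)).
[folklore] -/
theorem supDist_picardIter_succ_le (n : ℕ) :
    supDist T (picardIter ν u₀ (n + 1)) (picardIter ν u₀ n) ≤ M / 2 ^ n := by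
  have hM0 : 0 ≤ M := (norm_nonneg _).trans (hb 0)
  induction n with
  | zero =>
    rw [pow_zero, div_one]
    refine supDist_le hM0 fun t ht x => ?_
    rw [picardIter_succ_of_pos 0 ht.1, picardIter_zero_of_pos ht.1]
    dsimp only
    rw [sub_sub_cancel_left, norm_neg]
    exact (norm_mildDuhamel_picardIter_le hE hm hb hν hT 0 ht x).trans (by linarith)
  | succ n ih =>
    have h1 := isBddCtsVelocity_picardIter hE hm hb hν hT (n + 1)
    have h0 := isBddCtsVelocity_picardIter hE hm hb hν hT n
    refine supDist_le (by positivity) fun t ht x => ?_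
    rw [picardIter_succ_of_pos (n + 1) ht.1, picardIter_succ_of_pos n ht.1]
    dsimp only
    rw [sub_sub_sub_cancel_left]
    refine (norm_mildDuhamel_selfTensor_sub_le hE h1 h0 hν ht x).trans ?_
    have ht2 : t ^ (1 / 2 : ℝ) ≤ T ^ (1 / 2 : ℝ) := Real.rpow_le_rpow ht.1.le ht.2 (by norm_num)
    have hν0 : 0 ≤ ν ^ (-(1 / 2 : ℝ)) := Real.rpow_nonneg hν.le _
    have ht0 : 0 ≤ t ^ (1 / 2 : ℝ) := Real.rpow_nonneg ht.1.le _
    have hd0 : 0 ≤ supDist T (picardIter ν u₀ (n + 1)) (picardIter ν u₀ n) := supDist_nonneg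
    calc 17658 * ν ^ (-(1 / 2 : ℝ)) * ((2 * M + 2 * M) * supDist T (picardIter ν u₀ (n + 1)) (picardIter ν u₀ n)) *
          t ^ (1 / 2 : ℝ)
        ≤ 17658 * ν ^ (-(1 / 2 : ℝ)) * ((2 * M + 2 * M) * (M / 2 ^ n)) * T ^ (1 / 2 : ℝ) := by gcongr
      _ = (70632 * M * ν ^ (-(1 / 2 : ℝ)) * T ^ (1 / 2 : ℝ)) * (M / 2 ^ n) := by ring
      _ ≤ (1 / 2) * (M / 2 ^ n) := mul_le_mul_of_nonneg_right hT (by positivity)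
      _ = M / 2 ^ (n + 1) := by rw [pow_succ]; ring

/-- Pointwise form of the geometric decay on `(0, T]`. [folklore] -/
theorem dist_picardIter_succ_le (n : ℕ) {t : ℝ} (ht : t ∈ Ioc 0 T) (x : E) :
    dist (picardIter ν u₀ n t x) (picardIter ν u₀ (n + 1) t x) ≤ 2 * M / 2 / 2 ^ n := by
  rw [dist_comm, dist_eq_norm, show 2 * M / 2 / 2 ^ n = M / 2 ^ n by ring]
  have h1 := isBddCtsVelocity_picardIter hE hm hb hν hT (n + 1)
  have h0 := isBddCtsVelocity_picardIter hE hm hb hν hT n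
  exact (norm_sub_le_supDist (norm_sub_le_add_of_bounds h1.bound h0.bound) ht x).trans
    (supDist_picardIter_succ_le hE hm hb hν hT n)

end PicardLimit

section PicardLimitDef

variable {E : Type*} [NormedAddCommGroup E] [InnerProductSpace ℝ E] [FiniteDimensional ℝ E]
  [MeasurableSpace E] [BorelSpace E]

/-- **The limit of the Picard iteration** (pointwise `lim_{n → ∞} u⁽ⁿ⁾(t)(x)`; Leray 1934, §19:
"les fonctions `uᵢ⁽ⁿ⁾(x,t)` convergent uniformément vers des limites continues `uᵢ(x,t)`";
Ożański–Pooley 2018, (6.64)). At `t ≤ 0` it is the datum; for `t` beyond the contraction time it is a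
junk value. [folklore] -/
def picardLimit (ν : ℝ) (u₀ : E → E) (t : ℝ) (x : E) : E :=
  limUnder atTop fun n => picardIter ν u₀ n t x

variable {ν M T : ℝ} {u₀ : E → E}

/-- At nonpositive times the Picard limit is the datum. [folklore] -/
theorem picardLimit_of_nonpos {t : ℝ} (ht : t ≤ 0) (x : E) : picardLimit ν u₀ t x = u₀ x := by
  unfold picardLimit
  have : (fun n => picardIter ν u₀ n t x) = fun _ => u₀ x := funext fun n => picardIter_of_nonpos n ht x
  rw [this]
  exact tendsto_const_nhds.limUnder_eq

variable (hE : Module.finrank ℝ E = 3) (hm : AEStronglyMeasurable u₀ volume) (hb : ∀ z, ‖u₀ z‖ ≤ M)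
  (hν : 0 < ν) (hT : 70632 * M * ν ^ (-(1 / 2 : ℝ)) * T ^ (1 / 2 : ℝ) ≤ 1 / 2)
include hE hm hb hν hT

/-- **The Picard iterates converge to the Picard limit** on `(0, T]`. [folklore] -/
theorem tendsto_picardIter {t : ℝ} (ht : t ∈ Ioc 0 T) (x : E) :
    Tendsto (fun n => picardIter ν u₀ n t x) atTop (𝓝 (picardLimit ν u₀ t x)) :=
  (cauchySeq_of_le_geometric_two (dist_picardIter_succ_le hE hm hb hν hT · ht x)).tendsto_limUnder

/-- **Uniform geometric convergence**: `‖u⁽ⁿ⁾(t)(x) - u(t)(x)‖ ≤ 2M / 2ⁿ` on `(0, T]`. [folklore] -/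
theorem norm_picardIter_sub_picardLimit_le (n : ℕ) {t : ℝ} (ht : t ∈ Ioc 0 T) (x : E) :
    ‖picardIter ν u₀ n t x - picardLimit ν u₀ t x‖ ≤ 2 * M / 2 ^ n := by
  rw [← dist_eq_norm]
  exact dist_le_of_le_geometric_two_of_tendsto (dist_picardIter_succ_le hE hm hb hν hT · ht x)
    (tendsto_picardIter hE hm hb hν hT ht x) n

/-- The Picard limit is bounded by `2M` on `(0, T]`. [folklore] -/
theorem norm_picardLimit_le {t : ℝ} (ht : t ∈ Ioc 0 T) (x : E) : ‖picardLimit ν u₀ t x‖ ≤ 2 * M :=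
  le_of_tendsto ((continuous_norm.tendsto _).comp (tendsto_picardIter hE hm hb hν hT ht x))
    (Eventually.of_forall fun n => (isBddCtsVelocity_picardIter hE hm hb hν hT n).bound t ht x)

/-- **The slices of the Picard limit are continuous** (uniform limits of continuous slices). [folklore] -/
theorem continuous_picardLimit {t : ℝ} (ht : t ∈ Ioc 0 T) : Continuous (picardLimit ν u₀ t) := by
  have hM0 : 0 ≤ M := (norm_nonneg _).trans (hb 0)
  have hunif : TendstoUniformly (fun n => picardIter ν u₀ n t) (picardLimit ν u₀ t) atTop := by
    rw [Metric.tendstoUniformly_iff]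
    intro ε hε
    have hlim : Tendsto (fun n : ℕ => 2 * M / 2 ^ n) atTop (𝓝 0) := by
      exact tendsto_const_nhds.div_atTop (tendsto_pow_atTop_atTop_of_one_lt (one_lt_two (α := ℝ)))
    filter_upwards [hlim.eventually (gt_mem_nhds hε)] with n hn x
    rw [dist_comm, dist_eq_norm]
    exact (norm_picardIter_sub_picardLimit_le hE hm hb hν hT n ht x).trans_lt hn
  exact hunif.continuous (Frequently.of_forall fun n => continuous_picardIter hE hm hb hν hT n ht)

/-- **The Picard limit is a bounded, sup-norm continuous velocity with bound `2M`** on `(0, T]`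
(sup-norm continuity by an `ε/3` argument through a fixed iterate). [folklore] -/
theorem isBddCtsVelocity_picardLimit : IsBddCtsVelocity T (2 * M) (picardLimit ν u₀) := by
  have hM0 : 0 ≤ M := (norm_nonneg _).trans (hb 0)
  refine ⟨fun s hs => (continuous_picardLimit hE hm hb hν hT hs).aestronglyMeasurable,
    fun s hs y => norm_picardLimit_le hE hm hb hν hT hs y, by linarith, fun s hs => ?_⟩
  rw [ENNReal.tendsto_nhds_zero]
  intro ε hε
  by_cases hεtop : ε = ⊤
  · exact Eventually.of_forall fun _ => le_top.trans_eq hεtop.symm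
  set δ : ℝ := ε.toReal with hδ
  have hδpos : 0 < δ := ENNReal.toReal_pos hε.ne' hεtop
  have hεδ : ENNReal.ofReal δ = ε := ENNReal.ofReal_toReal hεtop
  -- choose the iterate
  have hlim : Tendsto (fun n : ℕ => 4 * M / 2 ^ n) atTop (𝓝 0) :=
    tendsto_const_nhds.div_atTop (tendsto_pow_atTop_atTop_of_one_lt (one_lt_two (α := ℝ)))
  obtain ⟨n, hn⟩ := (hlim.eventually (gt_mem_nhds (half_pos hδpos))).exists
  have hVn := isBddCtsVelocity_picardIter hE hm hb hν hT n
  have hcont := (ENNReal.tendsto_nhds_zero.1 (hVn.cont s hs)) (ENNReal.ofReal (δ / 2))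
    (ENNReal.ofReal_pos.2 (half_pos hδpos))
  filter_upwards [hcont, eventually_mem_nhdsWithin] with s' h1 hs'
  -- triangle inequality through the iterate `n`
  have hmeas : ∀ r ∈ Ioc 0 T, AEStronglyMeasurable (picardLimit ν u₀ r) volume := fun r hr =>
    (continuous_picardLimit hE hm hb hν hT hr).aestronglyMeasurable
  have hmeasn : ∀ r ∈ Ioc 0 T, AEStronglyMeasurable (picardIter ν u₀ n r) volume := fun r hr =>
    (continuous_picardIter hE hm hb hν hT n hr).aestronglyMeasurable
  have heq : (fun y => picardLimit ν u₀ s' y - picardLimit ν u₀ s y) =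
      (fun y => picardLimit ν u₀ s' y - picardIter ν u₀ n s' y) +
        ((fun y => picardIter ν u₀ n s' y - picardIter ν u₀ n s y) + fun y => picardIter ν u₀ n s y - picardLimit ν u₀ s y) := by
    funext y; simp only [Pi.add_apply]; abel
  rw [heq]
  have hA : eLpNorm (fun y => picardLimit ν u₀ s' y - picardIter ν u₀ n s' y) ∞ volume ≤ ENNReal.ofReal (2 * M / 2 ^ n) := by
    rw [eLpNorm_exponent_top]
    refine eLpNormEssSup_le_of_ae_bound (Eventually.of_forall fun y => ?_)
    rw [norm_sub_rev]; exact norm_picardIter_sub_picardLimit_le hE hm hb hν hT n hs' y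
  have hC : eLpNorm (fun y => picardIter ν u₀ n s y - picardLimit ν u₀ s y) ∞ volume ≤ ENNReal.ofReal (2 * M / 2 ^ n) := by
    rw [eLpNorm_exponent_top]
    exact eLpNormEssSup_le_of_ae_bound (Eventually.of_forall fun y => norm_picardIter_sub_picardLimit_le hE hm hb hν hT n hs y)
  calc _ ≤ eLpNorm (fun y => picardLimit ν u₀ s' y - picardIter ν u₀ n s' y) ∞ volume +
        eLpNorm ((fun y => picardIter ν u₀ n s' y - picardIter ν u₀ n s y) + fun y => picardIter ν u₀ n s y - picardLimit ν u₀ s y) ∞ volume :=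
        eLpNorm_add_le ((hmeas s' hs').sub (hmeasn s' hs')) (((hmeasn s' hs').sub (hmeasn s hs)).add ((hmeasn s hs).sub (hmeas s hs))) le_top
    _ ≤ ENNReal.ofReal (2 * M / 2 ^ n) + (ENNReal.ofReal (δ / 2) + ENNReal.ofReal (2 * M / 2 ^ n)) := by
        refine add_le_add hA ((eLpNorm_add_le ((hmeasn s' hs').sub (hmeasn s hs)) ((hmeasn s hs).sub (hmeas s hs)) le_top).trans
          (add_le_add h1 hC))
    _ = ENNReal.ofReal (4 * M / 2 ^ n + δ / 2) := by
        rw [← ENNReal.ofReal_add (by positivity) (by positivity), ← ENNReal.ofReal_add (by positivity) (by positivity)]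
        congr 1; ring
    _ ≤ ENNReal.ofReal δ := ENNReal.ofReal_le_ofReal (by linarith)
    _ = ε := hεδ

/-- **The Picard limit solves the mild Navier–Stokes equation** on `(0, T]`:
`u(t) = e^{νtΔ} u₀ - 𝒟_ν[u ⊗ u](t)` (Leray 1934, (3.2) with the approximations of §19; Ożański–Pooley
2018, Thm. 6.22: passage to the limit in the iteration). [folklore] -/
theorem picardLimit_eq_mild {t : ℝ} (ht : t ∈ Ioc 0 T) (x : E) :
    picardLimit ν u₀ t x = heatPart ν u₀ t x - mildDuhamel ν (selfTensor (picardLimit ν u₀)) t x := by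
  have hM0 : 0 ≤ M := (norm_nonneg _).trans (hb 0)
  have hv := isBddCtsVelocity_picardLimit hE hm hb hν hT
  -- the shifted iterates converge to the limit
  have h1 : Tendsto (fun n => picardIter ν u₀ (n + 1) t x) atTop (𝓝 (picardLimit ν u₀ t x)) :=
    (tendsto_add_atTop_iff_nat 1).2 (tendsto_picardIter hE hm hb hν hT ht x)
  -- and to the mild right-hand side
  have h2 : Tendsto (fun n => picardIter ν u₀ (n + 1) t x) atTop
      (𝓝 (heatPart ν u₀ t x - mildDuhamel ν (selfTensor (picardLimit ν u₀)) t x)) := by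
    have heq : ∀ n, picardIter ν u₀ (n + 1) t x =
        heatPart ν u₀ t x - mildDuhamel ν (selfTensor (picardIter ν u₀ n)) t x := fun n => by
      rw [picardIter_succ_of_pos n ht.1]
    simp_rw [heq]
    refine tendsto_const_nhds.sub ?_
    rw [tendsto_iff_norm_sub_tendsto_zero]
    have hbound : ∀ n, ‖mildDuhamel ν (selfTensor (picardIter ν u₀ n)) t x -
        mildDuhamel ν (selfTensor (picardLimit ν u₀)) t x‖ ≤
          17658 * ν ^ (-(1 / 2 : ℝ)) * ((2 * M + 2 * M) * (2 * M / 2 ^ n)) * t ^ (1 / 2 : ℝ) := by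
      intro n
      have hVn := isBddCtsVelocity_picardIter hE hm hb hν hT n
      refine (norm_mildDuhamel_selfTensor_sub_le hE hv hVn hν ht x).trans ?_
      have hd : supDist T (picardLimit ν u₀) (picardIter ν u₀ n) ≤ 2 * M / 2 ^ n :=
        supDist_le (by positivity) fun r hr y => by
          rw [norm_sub_rev]; exact norm_picardIter_sub_picardLimit_le hE hm hb hν hT n hr y
      have hν0 : 0 ≤ ν ^ (-(1 / 2 : ℝ)) := Real.rpow_nonneg hν.le _
      have ht0 : 0 ≤ t ^ (1 / 2 : ℝ) := Real.rpow_nonneg ht.1.le _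
      gcongr
    have hlim : Tendsto (fun n : ℕ => 17658 * ν ^ (-(1 / 2 : ℝ)) * ((2 * M + 2 * M) * (2 * M / 2 ^ n)) * t ^ (1 / 2 : ℝ))
        atTop (𝓝 0) := by
      have h0 : Tendsto (fun n : ℕ => 2 * M / 2 ^ n) atTop (𝓝 0) :=
        tendsto_const_nhds.div_atTop (tendsto_pow_atTop_atTop_of_one_lt (one_lt_two (α := ℝ)))
      have := ((h0.const_mul (2 * M + 2 * M)).const_mul (17658 * ν ^ (-(1 / 2 : ℝ)))).mul_const (t ^ (1 / 2 : ℝ))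
      simpa using this
    exact squeeze_zero (fun n => norm_nonneg _) hbound hlim
  exact tendsto_nhds_unique h1 h2

end PicardLimitDef

/-! ## Joint continuity; the packaged local existence theorem in `L^∞` -/

section Package

variable {E : Type*} [NormedAddCommGroup E] [InnerProductSpace ℝ E] [FiniteDimensional ℝ E]
  [MeasurableSpace E] [BorelSpace E]

/-- **A continuous function is everywhere bounded by its `L^∞` norm** (an open set of positive
measure cannot be null for an additive Haar measure). [folklore] -/
theorem norm_le_of_eLpNorm_top_le {F' : Type*} [NormedAddCommGroup F'] {f : E → F'} (hf : Continuous f) {C : ℝ}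
    (hC0 : 0 ≤ C)
    (hC : eLpNorm f ∞ volume ≤ ENNReal.ofReal C) (x : E) : ‖f x‖ ≤ C := by
  by_contra hlt
  have hlt' : C < ‖f x‖ := not_le.1 hlt
  set U : Set E := {y | C < ‖f y‖} with hU
  have hUo : IsOpen U := isOpen_lt continuous_const hf.norm
  have hUpos : 0 < volume U := hUo.measure_pos volume ⟨x, hlt'⟩
  have hae : ∀ᵐ y ∂(volume : Measure E), ‖f y‖ ≤ C := by
    have h1 := ae_le_eLpNormEssSup (f := f) (μ := (volume : Measure E))
    rw [← eLpNorm_exponent_top] at h1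
    filter_upwards [h1] with y hy
    have hy' : ‖f y‖ₑ ≤ ENNReal.ofReal C := hy.trans hC
    rw [← ofReal_norm] at hy'
    exact (ENNReal.ofReal_le_ofReal_iff hC0).1 hy'
  have hU0 : volume U = 0 := by
    rw [hU]
    refine measure_eq_zero_iff_ae_notMem.2 ?_
    filter_upwards [hae] with y hy hyU
    exact absurd hyU (not_lt.2 hy)
  exact absurd hU0 hUpos.ne'

/-- **Joint continuity of bounded, sup-norm continuous velocities with continuous slices** on
`(0, T] × E`. [folklore] -/
theorem IsBddCtsVelocity.continuousOn_uncurry {T M : ℝ} {v : ℝ → E → E} (hv : IsBddCtsVelocity T M v)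
    (hc : ∀ s ∈ Ioc 0 T, Continuous (v s)) : ContinuousOn (Function.uncurry v) (Ioc 0 T ×ˢ univ) := by
  rintro ⟨s, x⟩ ⟨hs, -⟩
  rw [ContinuousWithinAt, tendsto_iff_norm_sub_tendsto_zero]
  -- the sup-norm variation in time, as a real function tending to `0`
  set ω : ℝ → ℝ := fun s' => (eLpNorm (fun y => v s' y - v s y) ∞ volume).toReal with hω
  have hfin : ∀ s' ∈ Ioc 0 T, eLpNorm (fun y => v s' y - v s y) ∞ volume ≠ ∞ := fun s' hs' =>
    (memLp_top_of_bound ((hv.meas s' hs').sub (hv.meas s hs)) (M + M)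
      (Eventually.of_forall fun y => (norm_sub_le _ _).trans (add_le_add (hv.bound s' hs' y) (hv.bound s hs y)))).eLpNorm_ne_top
  have hωlim : Tendsto ω (𝓝[Ioc 0 T] s) (𝓝 0) := by
    have := (ENNReal.tendsto_toReal ENNReal.zero_ne_top).comp (hv.cont s hs)
    rwa [ENNReal.toReal_zero] at this
  have hωbound : ∀ s' ∈ Ioc 0 T, ∀ y, ‖v s' y - v s y‖ ≤ ω s' := fun s' hs' y =>
    norm_le_of_eLpNorm_top_le (f := fun y => v s' y - v s y) ((hc s' hs').sub (hc s hs)) ENNReal.toReal_nonneg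
      (by rw [ENNReal.ofReal_toReal (hfin s' hs')]) y
  -- pull back along the first projection, add the slice continuity
  have h1 : Tendsto (fun q : ℝ × E => ω q.1) (𝓝[Ioc 0 T ×ˢ univ] (s, x)) (𝓝 0) := by
    refine hωlim.comp ?_
    exact tendsto_nhdsWithin_of_tendsto_nhds_of_eventually_within _
      ((continuous_fst.tendsto (s, x)).mono_left nhdsWithin_le_nhds)
      (eventually_mem_nhdsWithin.mono fun q hq => hq.1)
  have h2 : Tendsto (fun q : ℝ × E => ‖v s q.2 - v s x‖) (𝓝[Ioc 0 T ×ˢ univ] (s, x)) (𝓝 0) := by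
    have hcx := ((hc s hs).tendsto x)
    have := (tendsto_iff_norm_sub_tendsto_zero.1 (hcx.comp (continuous_snd.tendsto (s, x))))
    exact this.mono_left nhdsWithin_le_nhds
  have h12 := h1.add h2
  rw [add_zero] at h12
  refine squeeze_zero_norm' ?_ h12
  filter_upwards [eventually_mem_nhdsWithin] with q hq
  rw [norm_norm]
  calc ‖Function.uncurry v q - Function.uncurry v (s, x)‖ = ‖v q.1 q.2 - v s x‖ := rfl
    _ ≤ ‖v q.1 q.2 - v s q.2‖ + ‖v s q.2 - v s x‖ := norm_sub_le_norm_sub_add_norm_sub _ _ _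
    _ ≤ ω q.1 + ‖v s q.2 - v s x‖ := add_le_add (hωbound q.1 hq.1 q.2) le_rfl

omit [NormedAddCommGroup E] [InnerProductSpace ℝ E] [FiniteDimensional ℝ E] [MeasurableSpace E] [BorelSpace E] in
/-- The contraction time `T₀ = ν / (141264 M)²` satisfies the smallness condition
`70632 M ν^{-1/2} T₀^{1/2} ≤ 1/2` (indeed with equality), and so does every `T ≤ T₀`. [folklore] -/
theorem picard_smallness {ν M T : ℝ} (hν : 0 < ν) (hM : 0 < M) (hT0 : 0 ≤ T)
    (hT : T ≤ ν / (141264 * M) ^ 2) :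
    70632 * M * ν ^ (-(1 / 2 : ℝ)) * T ^ (1 / 2 : ℝ) ≤ 1 / 2 := by
  have h1 : T ^ (1 / 2 : ℝ) ≤ (ν / (141264 * M) ^ 2) ^ (1 / 2 : ℝ) := Real.rpow_le_rpow hT0 hT (by norm_num)
  have h2 : (ν / (141264 * M) ^ 2) ^ (1 / 2 : ℝ) = ν ^ (1 / 2 : ℝ) / (141264 * M) := by
    rw [Real.div_rpow hν.le (by positivity), show ((141264 * M) ^ 2 : ℝ) = (141264 * M) ^ (2 : ℝ) by norm_cast,
      ← Real.rpow_mul (by positivity)]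
    norm_num
  rw [h2] at h1
  have hν0 : 0 < ν ^ (-(1 / 2 : ℝ)) := Real.rpow_pos_of_pos hν _
  have hkey : ν ^ (-(1 / 2 : ℝ)) * ν ^ (1 / 2 : ℝ) = 1 := by
    rw [← Real.rpow_add hν]; norm_num
  calc 70632 * M * ν ^ (-(1 / 2 : ℝ)) * T ^ (1 / 2 : ℝ)
      ≤ 70632 * M * ν ^ (-(1 / 2 : ℝ)) * (ν ^ (1 / 2 : ℝ) / (141264 * M)) := by gcongr
    _ = (70632 / 141264) * (M / M) * (ν ^ (-(1 / 2 : ℝ)) * ν ^ (1 / 2 : ℝ)) := by ring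
    _ = 1 / 2 := by rw [hkey, div_self hM.ne']; norm_num

variable (hE : Module.finrank ℝ E = 3)
include hE

/-- **Leray's local existence theorem in `L^∞`, mild form** (Leray 1934, §19, existence theorem with
(3.8) `τ = A ν V⁻²(0)`; Ożański–Pooley 2018, Thm. 6.22, the existence part, for bounded data): for
`ν > 0`, `M > 0` and a measurable datum `u₀` with `‖u₀‖ ≤ M` pointwise, on the time interval
`(0, T₀]`, `T₀ = ν / (141264 M)²`, the Picard limit `u` is a bounded (`‖u‖ ≤ 2M`), sup-norm
continuous velocity with continuous slices, jointly continuous on `(0, T₀] × E`, equal to `u₀` at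
`t ≤ 0`, and solves the mild Navier–Stokes equation `u(t) = e^{νtΔ} u₀ - 𝒟_ν[u ⊗ u](t)` pointwise.
[folklore] -/
theorem picardLimit_spec {ν M : ℝ} {u₀ : E → E} (hm : AEStronglyMeasurable u₀ volume)
    (hb : ∀ z, ‖u₀ z‖ ≤ M) (hM : 0 < M) (hν : 0 < ν) :
    IsBddCtsVelocity (ν / (141264 * M) ^ 2) (2 * M) (picardLimit ν u₀) ∧
    (∀ t ∈ Ioc 0 (ν / (141264 * M) ^ 2), Continuous (picardLimit ν u₀ t)) ∧
    ContinuousOn (Function.uncurry (picardLimit ν u₀)) (Ioc 0 (ν / (141264 * M) ^ 2) ×ˢ univ) ∧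
    (∀ t ≤ 0, ∀ x, picardLimit ν u₀ t x = u₀ x) ∧
    ∀ t ∈ Ioc 0 (ν / (141264 * M) ^ 2), ∀ x,
      picardLimit ν u₀ t x = heatPart ν u₀ t x - mildDuhamel ν (selfTensor (picardLimit ν u₀)) t x := by
  have hT := picard_smallness hν hM (by positivity) le_rfl (T := ν / (141264 * M) ^ 2)
  have hv := isBddCtsVelocity_picardLimit hE hm hb hν hT
  have hc : ∀ t ∈ Ioc 0 (ν / (141264 * M) ^ 2), Continuous (picardLimit ν u₀ t) := fun t ht =>
    continuous_picardLimit hE hm hb hν hT ht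
  exact ⟨hv, hc, hv.continuousOn_uncurry hc, fun t ht x => picardLimit_of_nonpos ht x,
    fun t ht x => picardLimit_eq_mild hE hm hb hν hT ht x⟩

end Package

end Literature.Analysis.FluidPDE

end
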